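import Mathlib
import HarnessLib
import HarnessLib.Audit
import Summits.KontsevichZagierPeriods.Statement
import HarnessLib.Audit.Status.Attr

/-!
Route: CarlsonRule

DORMANT since 2026-08-23T17:51:43Z (reconciler: no traction for 6.2 d (last activity item-evidence-added at 2026-08-17T13:32:20Z); parked, not closed — `ledger route dormant route-KontsevichZagierPeriods-CarlsonRule --off` to reactivate) — unstaffed, not closed; items shared with open routes are served there. `ledger route dormant <id> --off` reactivates.

# Route CarlsonRule — Carlson's rule — continuation in the exponent as a fifth move; derive it where
nothing else reaches, the exceptional coupling 5·G₂ = 6·A₂ at k = 1/3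

It suffices to show X = CarlsonClosure ∧ CarlsonKernel. CarlsonClosure (CARLSON'S RULE IS
ADMISSIBLE): whenever two families
[σ, f·g^m] and [τ, f'·g'^m] (0 ≤ g, g' ≤ M) are move-equivalent for every integer m ≥ 0, the
interpolated pair [σ, f·g^k] ~ [τ, f'·g'^k]
is move-equivalent for every rational k ≥ 0 — the finitary shadow of Carlson's theorem (a function
of exponential type vanishing on ℕ and
small on iℝ vanishes), which is the second half of every constant-term / Selberg-type evaluation in
print (ForresterWarnaar2008 pp. 3, 5, 6, 13).
CarlsonKernel (crux, ranked last): Conjecture 1 for the calculus KZ^C = four moves + Carlson's rule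
— summit-strength and
conjecture-grade (KZKernelConjecture ⇒ it; with CarlsonClosure it returns the summit), hence a
ranked crux this route must
discharge, not a target the other cruxes reach (route-choice 2026-08-16): no glue short of
Conjecture 1 itself leads to it, and it
has the shape of ExpConservative.ExpKernelConjecture / LiouvilleUnfolding.LogKernelConjecture /
ExponentCosets.CosetKernel.
X ⟺ the summit (⇐ via support CarlsonSound = Carlson 1914). Card realised:
exceptional-couplings-one-third-g2-over-a2 — the exceptional
Macdonald–Opdam anchors are the rule's PURE instances (integer points accessible by Weyl-denominator
combinatorics; no coupling and no algebraic
correspondence in print), so the ranked cruxes are the card's typed G₂ pairs: 5·G₂ ~ 6·A₂ on one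
torus (G2OverA2), Opdam's G₂ value at
k = 1/3 in Beta normal form (G2ThirdAnchor), the whole G₂ exponent line (G2OpdamLine), plus the rule
itself (CarlsonClosure) and the kernel statement for KZ^C (CarlsonKernel).
Lean: `CarlsonClosure ∧ CarlsonKernel`

## Assembly
Pure logic (Sketch.lean rc 0; the 3-line proof is glue.lean `closes`): given rational r, r' with
equal values, [r] − [r'] ∈ ker KZ.eval
(KZ.eval_of); CarlsonKernel at R := KZ.relations (le_rfl), whose closure hypothesis is literally
CarlsonClosure, gives [r] − [r'] ∈ KZ.relations,
i.e. KZ.Equivalent r r'. The concrete cruxes 2, 4, 5 enter the summit through CarlsonClosure (5 is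
its instance given G2OpdamLineNat and
TorusRepsExist; 4 is 5 at k = 1/3; 2 is 4 + the A₂ anchor + a Beta shift + cancellation) — they are
the tests of the line, not extra hypotheses
of `closes`; conversely CarlsonSound + KZKernelConjecture ⇒ X, so nothing weaker or stronger than
the summit is being decided.

Rationale: WHY THIS LINE. Mechanism: Carlson's theorem (Boas1954 Thm 9.2.1; AndrewsAskeyRoy1999 Thm 2.8.1)
turns identities at integer exponents into identities at all
exponents; it closes Selberg's, Dyson's (Gunson–Wilson–Good + Carlson), Morris's and Macdonald's
evaluations (ForresterWarnaar2008 pp. 3–8, 13: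
"analytic continuation off the integers is then required"), Gauss multiplication and Dougall
(AndrewsAskeyRoy1999 §2.8) and the WZ proofs of 1/π
series (Guillera2025); route WZCosetWall names this step "the coset wall" and compiles everything
but it, route Neg bets against its first Γ-instance
(0311). This route makes the step itself a fifth rule, records that the summit is exactly "the rule
is admissible" ∧ "Conjecture 1 for KZ^C"
(closes, 3 lines), and stakes admissibility on the one family where no competing proof exists to
transcribe: for types A/B/C/D the Macdonald
integrals ARE Selberg integrals (t = sin²θ, ForresterWarnaar2008 p. 8) with Anderson's
change-of-variables proof (doi:10.1515/form.1991.3.415) and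
the CMV Jacobian (doi:10.1155/s1073792804141597), whereas for G₂ at k ∉ ℕ every proof is integer
cases (Zeilberger doi:10.1137/0518065, Habsieger)
+ Carlson, or Opdam1989's shift operators (Heckman doi:10.1007/bf01239517) + continuation. Imported
areas: harmonic analysis on root systems
(Macdonald1982 conjectures, Heckman–Opdam shift operators) for the instances and their exact
rational constants (card observation (T): at k = 1/3
every exceptional integral is a rational multiple of a power of the A₂ integral, n₂(R) = n₀(R) for
G₂, F₄, E₆, E₇, E₈; G₂/A₂ = 6/5, re-verified here
by 600² torus quadrature: 1.199983); complex analysis of exponential type (Carlson,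
Phragmén–Lindelöf) for the rule and its soundness; proof theory
of the calculus (admissibility of an ω-premise rule) for the frame. What no prior route does: no
open route types a continuation rule (WZCosetWall:
summation rule; LiouvilleUnfolding: log rule; SelbergAMGM: Γ-sector as relators), none touches
root-system integrals, and the negatives index
(1 entry, convexity of a kinematic measure) is unrelated.

RANKED CRUXES. #2 G2OverA2 (crux) — COUPLING 1/3 ON ONE TORUS (card headline G2OverA2). In
tan-half-angle coordinates t ∈ ℝ² (e(t) = (1+it)/(1−it) = e^(iθ), J = 4/((1+t₀²)(1+t₁²)) = dθ/dt,
|Δ⁺_R(t)| = Π over the positive roots (a,b) of ‖1 − e(t₀)^a e(t₁)^b‖; G₂⁺ =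
(1,0),(0,1),(1,1),(2,1),(3,1),(3,2); its short roots (1,0),(1,1),(2,1) are an A₂ on the SAME torus)
the representations [ℝ², 5·J·|Δ⁺_G₂|^(2/3)] and [ℝ², 6·J·|Δ⁺_A₂|^(2/3)] are KZ-equivalent. Values
5·(2π)²·162/(5Γ(⅓)³) = 6·(2π)²·27/Γ(⅓)³ ≈ 332.6 (Macdonald1982 §2, Conj. 2.1 in integral form /
Opdam1989 Thm: I_R(k) = (2π)^r·Π binom(k·d_i, k); ratio binom(2,⅓)/binom(1,⅓) = 6/5; quadrature
1.199983). Foreseen derivation: G2ThirdAnchor + the A₂ anchor + one Beta shift give it multiplied by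
a common Beta factor, and the bare form then needs that factor CANCELLED (Neg's CancellationGap) —
or a direct same-torus chain, the prize. [difficulty: open-problem] (why it might fail: Every proof
of 5·I_G2(1/3) = 6·I_A2(1/3) continues in k (integer cases + Carlson, or Opdam's shift operators);
no Selberg/CMV coupling exists for G2 at k ∉ ℕ, and the bare form also needs a common Beta factor
cancelled. May be a Neg witness.) [Macdonald1982, Opdam1989, ForresterWarnaar2008,
doi:10.1137/0518065, doi:10.1155/s1073792804141597, KontsevichZagier2001]
#3 CarlsonClosure (crux) — CARLSON'S RULE IS ADMISSIBLE for the four-move calculus: for σ ⊆ ℝⁿ, τ ⊆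
ℝ^n', functions f, g on σ and f', g' on τ with 0 ≤ g, g' ≤ M, and representations r_m = [σ, f·g^m],
s_m = [τ, f'·g'^m] (m ∈ ℕ) with [r_m] − [s_m] ∈ KZ.relations for all m, every pair rk = [σ, f·g^k],
sk = [τ, f'·g'^k] with k ∈ ℚ, k ≥ 0, has [rk] − [sk] ∈ KZ.relations. Sound (support CarlsonSound:
the values agree by Carlson's theorem applied to z ↦ ∫f·g^(z+1) − ∫f'·g'^(z+1), exponential type log
M, bounded on iℝ), hence implied by the summit; together with accessible integer points it yields
Opdam's theorem for every root system at rational k (crux 5 for G₂), Selberg/Dyson/Morris at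
rational exponents, Gauss multiplication in Beta form for all rational arguments (hence Neg's
TriplicationAccessible 0312, the integer points of the triplication line being accessible by Beta
shifts; cf. WZCosetWall.TriplicationThirdShift) and Dougall — one typed statement for the whole
coset wall. [difficulty: open-problem] (why it might fail: An ω-rule: admissibility needs, instance
by instance, ONE finite chain replacing infinitely many unrelated integer-point chains; it implies
every coset anchor at once (Gauss triplication = ¬(Neg 0311), all Opdam values) — a single Neg
witness kills it and the summit.) [Boas1954, AndrewsAskeyRoy1999, ForresterWarnaar2008,
Guillera2025, KontsevichZagier2001, HuberMullerStach2017]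
#4 G2ThirdAnchor (crux) — OPDAM'S G₂ VALUE AT k = 1/3 IN BETA NORMAL FORM (pure Carlson instance, no
cancellation needed): on D = ℝ² × (0,1)² the representations [D, J·(|Δ⁺_G₂|²·x(1−x)·y(1−y)⁵)^(1/3)]
and [D, J·(x²y⁶)^(1/3)] are KZ-equivalent (both (2π)²/5: I_G₂(⅓)·B(4/3,4/3)·B(4/3,8/3) =
(2π)²/((5/3)·3) and ∫ u^(2/3) v² = (3/5)(1/3); quadrature 0.99998). It is the k = 1/3 point of crux
5, whose integer points are support G2OpdamLineNat; CarlsonClosure + G2OpdamLineNat + TorusRepsExist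
⇒ it by pure logic. A chain found WITHOUT the rule is the first coupling-free exceptional evaluation
inside rules 1)–3) and the template for admissibility. [difficulty: XL] (why it might fail: Only
integer k is reached by constant terms (Zeilberger 1987, Habsieger 1986) and only continuation in k
reaches 1/3 (Opdam 1989; Carlson); no change of variables to a Selberg integral is known for G2,
unlike A/B/C/D (t = sin²θ, Anderson). Possibly a Neg pair.) [Opdam1989, Macdonald1982,
ForresterWarnaar2008, doi:10.1137/0518065, doi:10.1007/bf01239517]
#5 G2OpdamLine (crux) — THE WHOLE G₂ EXPONENT LINE (gen-1 item, re-typed with EqOn): for every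
rational k ≥ 0, [D, J·(|Δ⁺_G₂|²·x(1−x)·y(1−y)⁵)^k] ~ [D, J·(x²y⁶)^k] (I_G₂(k)·B(k+1,k+1)·B(k+1,5k+1)
= (2π)²/((2k+1)(6k+1)); both weights RATIONAL functions with ℚ-coefficients, bounded by 69 and 1;
only the exponent is fractional). Literally an instance of CarlsonClosure (n = n' = 4, f = f' = J, M
= 4096) given G2OpdamLineNat and TorusRepsExist; conversely a rule-free proof needs a mechanism
uniform across all cosets k₀ + ℕ (the Heckman–Opdam shift k → k+1 is plausibly a move chain, gen-1
ShiftIsMoves; the anchors k₀ ∈ (0,1) are the content). [deps: G2OpdamLineNat] [difficulty: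
open-problem] (why it might fail: At k ∉ ℕ the only proofs are Opdam/Heckman shift operators +
continuation, or integer cases + Carlson; a finitary uniform-in-k mechanism would be a derivation of
Carlson's rule on this family — none is known; one inaccessible anchor refutes it and the summit.)
[Opdam1989, doi:10.1007/bf01239517, Macdonald1982, AndrewsAskeyRoy1999, ForresterWarnaar2008]
#6 CarlsonKernel (crux; stmt-KontsevichZagierPeriods-14426, re-filed 1:1 from the former target #0
stmt-12254 at the route-choice of 2026-08-16) — Conjecture 1 for KZ^C: ker KZ.eval is contained in
every subgroup R ≥ KZ.relations closed under Carlson's rule (phrased over R exactly as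
WZCosetWall.SeriesKernel / LiouvilleUnfolding.LogKernelConjecture). KZKernelConjecture ⇒ it
trivially (Sketch.lean example); with CarlsonClosure it gives the summit back (closes), so it is a
load-bearing hypothesis of `closes` that none of the cruxes 2–5 reaches; being conjecture-grade it
is therefore a ranked CRUX of this route (2026-08-16 ruling: conjecture-grade items are cruxes,
never targets/supports), of the same shape and standing as ExpConservative.ExpKernelConjecture,
LiouvilleUnfolding.LogKernelConjecture and ExponentCosets.CosetKernel. Ranked last: it moves only
with the structural kernel programme (a proof of KZKernelConjecture by any route closes it
outright), while refuters read it as the summit minus analytic continuation in exponents and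
disprovers can settle its exact standing (CarlsonKernel ⟺ ker KZ.eval ≤ the Carlson closure of
KZ.relations; CarlsonKernel ∧ CarlsonClosure ⟺ KZKernelConjecture given CarlsonSound — cf.
Cruxes/LogKernelConjecture/Disproof.lean for the log rule). (why it might fail: False only if the
summit is (KZKernelConjecture ⇒ it); as an obligation it is Conjecture 1 for KZ^C: every Neg
pressure point off the exponent direction — regularisation, log/arctan primitives, cancellation of a
non-zero period — bears on it.) [KontsevichZagier2001, HuberMullerStach2017, Ayoub2015, Boas1954]
#9 G2OpdamLineNat (support) — INTEGER POINTS ARE ACCESSIBLE: for m ∈ ℕ the two representations of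
G2OpdamLine (rational integrands, monoid power) are KZ-equivalent — expand |Δ⁺_G₂|^(2m) into
characters (Weyl denominator; constant term Π binom(m·d_i, m), = 12 = |W(G₂)| at m = 1,
Macdonald1982 §1), kill every non-constant character e^(i(pθ₀+qθ₁)) by one Newton–Leibniz move on
the torus with a RATIONAL primitive in t, evaluate the Beta/monomial sides by polynomial primitives,
and match the integers by additivity (no division: both sides carry the same integers). [difficulty:
L] [Macdonald1982, Opdam1989, doi:10.1137/0518065, ForresterWarnaar2008]
#9 CarlsonSound (support) — VALUE-LEVEL SOUNDNESS OF THE RULE (Carlson 1914): under the hypotheses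
of CarlsonClosure with "∈ relations" replaced by equality of values for all m ∈ ℕ, rk.value =
sk.value for every rational k ≥ 0. Proof: H(z) = ∫_σ f·g^z·1_(g>0) − ∫_τ f'·g'^z·1_(g'>0) is
analytic on Re z > 0 with |H(z)| ≤ (‖f‖₁+‖f'‖₁)·max(1,M)^(Re z); z ↦ H(z+1) is regular of
exponential type on Re z ≥ 0, bounded on iℝ and zero on ℕ, so it vanishes (Boas1954 Thm 9.2.1,
indicator 0 < π), H ≡ 0 on Re z > 0 by the identity theorem, and k = 0 is the case m = 0. Mathlib
has Phragmén–Lindelöf (Complex.PhragmenLindelof); Carlson's theorem itself is to be proved in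
Literature/Analysis/Complex. Makes summit ⇒ X formal, so X ⟺ summit. [difficulty: L] [Boas1954,
AndrewsAskeyRoy1999, ForresterWarnaar2008]
#9 G2HalfRational (support) — THE k = 1/2 ANCHOR IS RATIONAL AND CONTINUATION-FREE (card (H),
calibration): [ℝ², J·|Δ⁺_G₂|] ~ [(0,1)², 512/5] (I_G₂(½) = (2π)²·binom(1,½)·binom(3,½) = 512/5;
quadrature 102.39999999). In t-coordinates the integrand is 256·|P(t)|/((1+t₀²)⁶(1+t₁²)⁴), P = Π
over G₂⁺ of Im[(1+it₀)^a(1+it₁)^b] ∈ ℤ[t₀,t₁] of degree 16: PIECEWISE RATIONAL on the sign cells of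
P, so the chain is cell decomposition (1a) + rational-function integration with arctan/log unfolded
into extra variables (engines of routes LiouvilleUnfolding / CompiledSubstitutions): the coset 1/2 +
ℤ needs no continuation, in contrast with 1/3 + ℤ. [difficulty: L] [Macdonald1982, Opdam1989,
KontsevichZagier2001]
#9 TorusRepsExist (support) — NON-VACUITY: for every rational k ≥ 0 the torus representations [ℝ²,
J·|Δ⁺_G₂|^(2k)], [ℝ², J·|Δ⁺_A₂|^(2k)] and the two Opdam-line representations on D exist as
KZ.IntegralRep (ℚ-semialgebraic: ‖1 − e(t₀)^a e(t₁)^b‖² is a rational function of t, so the graph of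
a (p/q)-th power is cut out by v ≥ 0 ∧ v^q·den^p = num^p; integrable: bounded × J ∈ L¹(ℝ²), resp.
bounded on a finite-measure fibre). [difficulty: M] [KontsevichZagier2001, Macdonald1982]

TWO-LAYER PLAN. Foreseen glued splits (none filed now; k ≤ 3, depth 1). G2ThirdAnchor ⇐ CubicIsogeny
→ MorrisThird → G2ThirdAnchor: Zeilberger's reduction
G₂ ← Morris n = 3 (doi:10.1137/0518065; ForresterWarnaar2008 p. 8) transcribed at the INTEGRAL level
for fractional k — the long-root A₂ of G₂
is the pull-back of the short-root A₂ under the 3-isogeny of the torus, realised as 9 injective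
rule-2 pieces after a (1a) dissection — followed by
the resulting Morris/Selberg-type integral at exponent 1/3 via Anderson's change of variables;
whether the constant-term sieving survives at k ∉ ℕ is
exactly the open point. G2OverA2 ⇐ G2ThirdsProduct (3·[D,
J|Δ⁺_G₂|^(2/3)(x(1−x))^(1/3)y^(1/3)(1−y)^(5/3)] ~ 2·[D, J|Δ⁺_A₂|^(2/3)(x(1−x))^(1/3)
y^(1/3)(1−y)^(2/3)], from G2ThirdAnchor, the A₂ anchor and monomial integrals by transitivity) →
BetaCancellation (cancel the common factor
[(0,1)², (x(1−x))^(1/3)y^(1/3)(1−y)^(2/3)] after the accessible shift B(4/3,8/3) = (5/9)·B(4/3,5/3))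
→ G2OverA2. G2OpdamLine ⇐ G2OpdamLineNat →
(CarlsonClosure restricted to f = f' = J) → G2OpdamLine. CarlsonClosure: no split foreseen (abstract
ω-rule; progress = instances).

KILL CRITERIA. A REFUTATION of G2OverA2, G2ThirdAnchor or G2OpdamLine (an additive invariant of
KZ.FormalRep vanishing on the four move sets and separating the
pair) refutes CarlsonClosure AND the H21-literal summit: close `refuted:<Decl>` and hand the witness
to route Neg as a new pressure point
(exponent interpolation). CarlsonClosure refuted at any other instance: same. If Neg's
TriplicationAccessible (0312) is REFUTED, CarlsonClosure is
false (it implies 0312 given the accessible integer points of the triplication line): close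
`refuted:CarlsonClosure`. If G2ThirdAnchor
is PROVED by a continuation-free chain, the exceptional premise is spent: tenure pivots to F₄/E₈
(definition request rootTorusRep) and to
CarlsonClosure on the next rule-only family. A certified numerical MISMATCH in a stated constant
means a transcription slip (all constants checked
against Γ-arithmetic and 600² quadrature) — restate, do not close. KZKernelConjecture proved by any
structural route (NoriTransfer, Grothendieck,
ExpConservative, AyoubSpecialisation) moots this one (X ⟺ summit). CarlsonKernel itself is refutable
only together with the summit (KZKernelConjecture ⇒ it): a claimed ¬CarlsonKernel is a claimed
¬KontsevichZagierPeriods and is handled as such; its closing other than via KZKernelConjecture would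
be a completeness theorem for KZ^C.

NOT DECOMPOSED YET. The A₂ anchor at 1/3 in Beta normal form ([D, J·(|Δ⁺_A₂|²x(1−x)y(1−y)²)^(1/3)] ~
[D, J·(x²y³)^(1/3)], both 3(2π)²/10; expected accessible through
the CMV/Killip–Nenciu Jacobian — territory of card matrix-model-couplings-anderson-selberg) and
BetaCancellation (layer-2 children of G2OverA2);
the shift engine ShiftIsMoves of gen-1 (Heckman's elementary shift operators for I₂(6) via Dunkl
operators as divergence-form Newton–Leibniz moves;
XL; not needed by the Carlson frame, filed only if G2ThirdAnchor moves); the F₄/E₆/E₇/E₈ thirds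
identities (q_R = 972/385, 6561/1540,
209952/17017, 2³3³³/(7²·11²·13³·17²·19·23²·29)) and the E₈ half-integer rational value
2¹²⁷/12762726426871747168694977125 (need positive-root
data as a definition); Carlson's rule for negative or two-sided exponents and for several
simultaneous exponents (Selberg's three); the negative
statements ¬G2OverA2 / ¬CarlsonClosure as ranked items (route Neg may want them).

CHEAPEST FALSIFIER. (i) Certified quadrature (kit, interval arithmetic on sign cells, 30 digits) of
the three G₂ pairs — run crudely here (numcheck.py, 600² midpoint
rule on the torus): I_G₂(⅓)/I_A₂(⅓) = 1.199983 vs 6/5, I_G₂(½) = 102.39999999 vs 512/5, CT(G₂,1) =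
12.0000000, G₂ and A₂ Opdam lines at 1/3
= 0.99998, 0.99999 (cusp error ~1e-5); Γ-arithmetic exact. (ii) LOOKUP that would demote (not
refute) cruxes 2/4: does Zeilberger 1987
(doi:10.1137/0518065) or Habsieger 1986 reduce the G₂ INTEGRAL at real k to Morris/Selberg, not only
constant terms at integer k?
ForresterWarnaar2008 p. 8, read today, leaves it at integer k; a real-k reduction would make G₂ a
'coupling exists' target and move the exceptional
premise to F₄. (iii) LOGIC CHECK for refuters: CarlsonClosure ⇒ ¬(Neg 0311) needs only the
accessible integer points of the triplication line —
if stamped, Neg #2 and this route's #3 are negations of each other up to provable glue, and one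
refuter verdict settles both.

NUMBERS. I_R(k)/(2π)^r = Π_i binom(k·d_i, k) (Macdonald1982 §2; Opdam1989 Thm); d(G₂) = 2, 6; d(A₂)
= 2, 3. CT(A₂,⅓) = 27/Γ(⅓)³ = 1.404351;
CT(G₂,⅓) = 162/(5Γ(⅓)³) = 1.685221; ratio 6/5 (quadrature 1.199983). I_G₂(½) = 512/5; CT(G₂,1) = 12,
CT(A₂,1) = 6 (quadrature 12.0000000,
6.0000000). Opdam lines: I_G₂(k)·B(k+1,k+1)·B(k+1,5k+1) = (2π)²/((2k+1)(6k+1));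
I_A₂(k)·B(k+1,k+1)·B(k+1,2k+1) = (2π)²/((2k+1)(3k+1)); at k = 1/3
both G₂ sides of G2ThirdAnchor are (2π)²/5, both A₂ sides 3(2π)²/10. Bounds for the CarlsonClosure
instance: |Δ⁺_G₂|² ≤ 4⁶ = 4096,
|Δ⁺_G₂|²·x(1−x)·y(1−y)⁵ ≤ 4096·¼·5⁵/6⁶ = 68.6, x²y⁶ ≤ 1 (take M = 4096). Carlson's constant: growth
e^(c|y|) with c < π on iℝ (sin πz extremal);
here c = 0. k = 1/3 ratios for the other exceptional types (card (T), verified by the card's audit):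
q_F₄ = 972/385, q_E₆ = 6561/1540,
q_E₇ = 209952/17017, q_E₈ = 2³3³³/(7²11²13³17²·19·23²·29) ≈ 40.53. Items at open: 10 (1 target, 4
cruxes, 4 support, 1 assembly); after the route-choice of 2026-08-16: 10 (5 cruxes, 4 support, 1
assembly; no target — X is the conjunction of the cruxes CarlsonClosure and CarlsonKernel).

DEFINITION REQUESTS. None for the typed items (explicit products over the six G₂ roots). Tenure,
after G2ThirdAnchor moves: `rootTorusRep (Φ⁺ : List (Fin r → ℕ))
(k : ℚ) : KZ.IntegralRep r` with the positive-root data of F₄, E₆, E₇, E₈ (topic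
Summits/KontsevichZagierPeriods/KontsevichZagierPeriods/Theorems).
Facts: Carlson's theorem (Boas1954 Thm 9.2.1 / AndrewsAskeyRoy1999 Thm 2.8.1) should be PROVED in
Literature/Analysis/Complex from Mathlib's
Phragmén–Lindelöf rather than cited, since CarlsonSound wants it as a theorem; Opdam1989's
evaluation (values for Re k ≥ 0) is useful to
refuters' value checks but is not a hypothesis of any item.

Novelty: Searches (2026-08-15): in-tree — all 87 Theses files of the sub grepped for Carlson / continuation
rule (WZCosetWall ×20: names the step, files no rule; its decls are SeriesKernel, BauerAccessible,
BauerHalfShift, TriplicationThirdShift, SummationClosure, ResummedPrimitiveNL, BauerAnchorOne,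
ZetaTwoOddEven; BoundaryLevel/HodgeLevel/RealPeriodGerms cite J. Carlson's Hodge papers; gen-1
ExceptionalCouplings), Ideas/*.md grepped (Carlson in 2 cards: this one and
matrix-model-couplings-anderson-selberg), `lean search -i carlson` over Mathlib + project (F.
Carlson's theorem absent; only Carlson's MHS extension theorem), `ledger negatives --problem
KontsevichZagierPeriods` (1, unrelated); `lit search --hybrid "Carlson's theorem uniqueness
exponential type integers hypergeometric identity proof"` (vector leg, 12 books: Ismail2005 p. 91,
Laughlin2017, none on periods); `lit galaxy search "Carlson's theorem" --star all` (50 rows: Boas,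
Askey 1975, AndrewsAskeyRoy, Borwein–Straub–Wan–Zudilin short-walk moments continued off the
integers by Carlson, Guillera WZ, replica-trick physics — nothing joining Carlson to KZ's rules);
`lit galaxy search "Macdonald conjecture for G2" --star all` (0); `lit galaxy search "root system G2
Selberg integral" --star pdf --mode bm25` (15; the relevant hit is ForresterWarnaar2008 itself);
`lit read arxiv:0710.3981 --grep Carlson|Opdam|G2|Zeilberger|Habsieger` (55 lines on 14 pp.; pp. 3,
5, 6, 7, 8, 13, 15 read); remote cascade (`lit search --source all`, f  [refs: 10.1016/j.geomphys.2019.06.006, 10.1137/0518065, 0710.3981, arxiv:0710.3981, doi:10.1016/j.geomphys.2019.06.006, doi:10.1137/0518065, ForresterWarnaar2008, Opdam1989, AndrewsAskeyRoy1999]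

Barriers (technique_class: carlson-rule, rule-closure, root-system-anchors): - technique_class: carlson-rule, rule-closure, root-system-anchors
- Literature.Barriers.KontsevichZagierPeriods.noSemialgebraicPrimitive_inv_sub_two: not engaged by
cruxes 2–5 (no primitive in an integration variable is proposed; the rule interpolates exponents,
and integer points use rational primitives of trigonometric polynomials); engaged only by support
G2HalfRational (cellwise primitives of rational functions are arctan/log) and evaded there by
unfolding into extra variables, the catalogued 'add variables' evasion.
- Literature.Barriers.KontsevichZagierPeriods.kzConjecture_implies_oddZetaAlgIndep: conceded for the
target CarlsonKernel (summit-strength by design, stated in its block); not engaged by CarlsonClosure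
and the G₂ items, which assert DERIVABILITY of identities that are theorems (Opdam1989) with
rational constants and imply no irrationality or independence statement.
- Literature.Barriers.KontsevichZagierPeriods.kzConjecture_implies_twoPiI_log_algIndep: same —
conceded for the target, not engaged by the cruxes (no logarithms occur; all constants rational).
- Literature.Barriers.KontsevichZagierPeriods.kzConjecture_implies_ellipticPeriods_algIndep: not
engaged (Γ(⅓)³ is a CM period of the hexagonal curve, but only the ratio 6/5 and Beta normal forms
are asserted, never independence).
- Literature.Barriers.KontsevichZagierPeriods.cressonViuSos_prop_3_2: not engaged — no global
semialgebraic map between two domains is claimed; the foreseen CubicIsogeny split uses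

History (route lifecycle, newest last):
- 2026-08-16T03:24:10Z · rev 5: dropped CarlsonKernel — route-choice follow-up (rank): CarlsonKernel must be ranked LAST (6), not 0 — rank 0 was its former target slot and would make it the route's top-served crux (p (planner-rchoice-KontsevichZagierPeriods-Carlso-ea60599a-0)
- 2026-08-23T17:51:43Z · DORMANT — reconciler: no traction for 6.2 d (last activity item-evidence-added at 2026-08-17T13:32:20Z); parked, not closed — `ledger route dormant route-KontsevichZagier (operator:999:1534289)

sub-problem: KontsevichZagierPeriods · status: dormant · opened planner-plancard-KontsevichZagierPeriods-Kont-fcbef4f7-g2-0 2026-08-15T18:51:53Z · rev 7 · ledger route-KontsevichZagierPeriods-CarlsonRule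
GENERATED by the gate from the ledger (D-0016/17). Provers cite these decls: `theorem foo : Summit.KontsevichZagierPeriods.KontsevichZagierPeriods.Theses.CarlsonRule.<Decl> := …` in Summits/KontsevichZagierPeriods/KontsevichZagierPeriods/Theorems/<Name>.lean.
-/

namespace Summit.KontsevichZagierPeriods.KontsevichZagierPeriods.Theses.CarlsonRule

open scoped BigOperators Topology Manifold Classical MeasureTheory ProbabilityTheory Matrix InnerProductSpace ComplexConjugate ContinuousMap
open Filter Set Function TopologicalSpace MeasureTheory

attribute [summit_statement] _root_.KontsevichZagierPeriods

open Literature Periods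

/-- item stmt-KontsevichZagierPeriods-12255 · crux · rank 2 · open · by planner
why it might fail: Every proof of 5·I_G2(1/3) = 6·I_A2(1/3) continues in k (integer cases + Carlson, or Opdam's shift operators); no Selberg/CMV coupling exists for G2 at k ∉ ℕ, and the bare form also needs a common Beta factor cancelled. May be a Neg witness.
sources: Macdonald1982, Opdam1989, ForresterWarnaar2008, doi:10.1137/0518065, doi:10.1155/s1073792804141597, KontsevichZagier2001
[crux] COUPLING 1/3 ON ONE TORUS (card headline G2OverA2). In tan-half-angle coordinates t ∈ ℝ²
(e(t) = (1+it)/(1−it) = e^(iθ), J = 4/((1+t₀²)(1+t₁²)) = dθ/dt, |Δ⁺_R(t)| = Π over the positive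
roots (a,b) of ‖1 − e(t₀)^a e(t₁)^b‖; G₂⁺ = (1,0),(0,1),(1,1),(2,1),(3,1),(3,2); its short roots
(1,0),(1,1),(2,1) are an A₂ on the SAME torus) the representations [ℝ², 5·J·|Δ⁺_G₂|^(2/3)] and [ℝ²,
6·J·|Δ⁺_A₂|^(2/3)] are KZ-equivalent. Values 5·(2π)²·162/(5Γ(⅓)³) = 6·(2π)²·27/Γ(⅓)³ ≈ 332.6
(Macdonald1982 §2, Conj. 2.1 in integral form / Opdam1989 Thm: I_R(k) = (2π)^r·Π binom(k·d_i, k);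
ratio binom(2,⅓)/binom(1,⅓) = 6/5; quadrature 1.199983). Foreseen derivation: G2ThirdAnchor + the A₂
anchor + one Beta shift give it multiplied by a common Beta factor, and the bare form then needs
that factor CANCELLED (Neg's CancellationGap) — or a direct same-torus chain, the prize.
[difficulty: open-problem] -/
@[route_item "route-KontsevichZagierPeriods-CarlsonRule"]
def G2OverA2 : Prop :=
  let e : ℝ → ℂ := fun s => (1 + (s : ℂ) * Complex.I) / (1 - (s : ℂ) * Complex.I); let J : (Fin 2 → ℝ) → ℝ := fun t => 4 / ((1 + t 0 ^ 2) * (1 + t 1 ^ 2)); let AG : (Fin 2 → ℝ) → ℝ := fun t => ∏ ρ ∈ ({(1, 0), (0, 1), (1, 1), (2, 1), (3, 1), (3, 2)} : Finset (ℕ × ℕ)), ‖1 - e (t 0) ^ ρ.1 * e (t 1) ^ ρ.2‖; let AA : (Fin 2 → ℝ) → ℝ := fun t => ∏ ρ ∈ ({(1, 0), (1, 1), (2, 1)} : Finset (ℕ × ℕ)), ‖1 - e (t 0) ^ ρ.1 * e (t 1) ^ ρ.2‖; ∀ (r r' : Literature.NumberTheory.Transcendental.KZ.IntegralRep 2), r.domain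 = Set.univ → (∀ t, r.integrand t = 5 * (J t * AG t ^ (2 / 3 : ℝ))) → r'.domain = Set.univ → (∀ t, r'.integrand t = 6 * (J t * AA t ^ (2 / 3 : ℝ))) → Literature.NumberTheory.Transcendental.KZ.Equivalent r r'

/-- item stmt-KontsevichZagierPeriods-12256 · crux · rank 3 · open · by planner
why it might fail: An ω-rule: admissibility needs, instance by instance, ONE finite chain replacing infinitely many unrelated integer-point chains; it implies every coset anchor at once (Gauss triplication = ¬(Neg 0311), all Opdam values) — a single Neg witness kills it and the summit.
sources: Boas1954, AndrewsAskeyRoy1999, ForresterWarnaar2008, Guillera2025, KontsevichZagier2001, HuberMullerStach2017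
[crux] CARLSON'S RULE IS ADMISSIBLE for the four-move calculus: for σ ⊆ ℝⁿ, τ ⊆ ℝ^n', functions f, g
on σ and f', g' on τ with 0 ≤ g, g' ≤ M, and representations r_m = [σ, f·g^m], s_m = [τ, f'·g'^m] (m
∈ ℕ) with [r_m] − [s_m] ∈ KZ.relations for all m, every pair rk = [σ, f·g^k], sk = [τ, f'·g'^k] with
k ∈ ℚ, k ≥ 0, has [rk] − [sk] ∈ KZ.relations. Sound (support CarlsonSound: the values agree by
Carlson's theorem applied to z ↦ ∫f·g^(z+1) − ∫f'·g'^(z+1), exponential type log M, bounded on iℝ),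
hence implied by the summit; together with accessible integer points it yields Opdam's theorem for
every root system at rational k (crux 5 for G₂), Selberg/Dyson/Morris at rational exponents, Gauss
multiplication in Beta form for all rational arguments (hence Neg's TriplicationAccessible 0312, the
integer points of the triplication line being accessible by Beta shifts; cf.
WZCosetWall.TriplicationThirdShift) and Dougall — one typed statement for the whole coset wall.
[difficulty: open-problem] -/
@[route_item "route-KontsevichZagierPeriods-CarlsonRule", crux]
def CarlsonClosure : Prop :=
  ∀ (n n' : ℕ) (σ : Set (Fin n → ℝ)) (τ : Set (Fin n' → ℝ)) (f g : (Fin n → ℝ) → ℝ) (f' g' : (Fin n' → ℝ) → ℝ) (M : ℝ) (r : ℕ → Literature.NumberTheory.Transcendental.KZ.IntegralRep n) (s : ℕ → Literature.NumberTheory.Transcendental.KZ.IntegralRep n'), (∀ x ∈ σ, 0 ≤ g x ∧ g x ≤ M) → (∀ y ∈ τ, 0 ≤ g' y ∧ g' y ≤ M) → (∀ m, (r m).domain = σ ∧ Set.EqOn (r m).integrand (fun x => f x * g x ^ m) σ) → (∀ m, (s m).domain = τ ∧ Set.EqOn (s m).integrand (fun y => f' y * g' y ^ m) τ) → (∀ m,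 Literature.NumberTheory.Transcendental.KZ.of (r m) - Literature.NumberTheory.Transcendental.KZ.of (s m) ∈ Literature.NumberTheory.Transcendental.KZ.relations) → ∀ (k : ℚ), 0 ≤ k → ∀ (rk : Literature.NumberTheory.Transcendental.KZ.IntegralRep n) (sk : Literature.NumberTheory.Transcendental.KZ.IntegralRep n'), rk.domain = σ → Set.EqOn rk.integrand (fun x => f x * g x ^ (k : ℝ)) σ → sk.domain = τ → Set.EqOn sk.integrand (fun y => f' y * g' y ^ (k : ℝ)) τ → Literature.NumberTheory.Transcendental.KZ.of rk - Literature.NumberTheory.Transcendental.KZ.of sk ∈ Literature.NumberTheory.Transcendental.KZ.relations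

/-- item stmt-KontsevichZagierPeriods-12257 · crux · rank 4 · open · by planner
why it might fail: Only integer k is reached by constant terms (Zeilberger 1987, Habsieger 1986) and only continuation in k reaches 1/3 (Opdam 1989; Carlson); no change of variables to a Selberg integral is known for G2, unlike A/B/C/D (t = sin²θ, Anderson). Possibly a Neg pair.
sources: Opdam1989, Macdonald1982, ForresterWarnaar2008, doi:10.1137/0518065, doi:10.1007/bf01239517
[crux] OPDAM'S G₂ VALUE AT k = 1/3 IN BETA NORMAL FORM (pure Carlson instance, no cancellation
needed): on D = ℝ² × (0,1)² the representations [D, J·(|Δ⁺_G₂|²·x(1−x)·y(1−y)⁵)^(1/3)] and [D,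
J·(x²y⁶)^(1/3)] are KZ-equivalent (both (2π)²/5: I_G₂(⅓)·B(4/3,4/3)·B(4/3,8/3) = (2π)²/((5/3)·3) and
∫ u^(2/3) v² = (3/5)(1/3); quadrature 0.99998). It is the k = 1/3 point of crux 5, whose integer
points are support G2OpdamLineNat; CarlsonClosure + G2OpdamLineNat + TorusRepsExist ⇒ it by pure
logic. A chain found WITHOUT the rule is the first coupling-free exceptional evaluation inside rules
1)–3) and the template for admissibility. [difficulty: XL] -/
@[route_item "route-KontsevichZagierPeriods-CarlsonRule"]
def G2ThirdAnchor : Prop :=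
  let e : ℝ → ℂ := fun s => (1 + (s : ℂ) * Complex.I) / (1 - (s : ℂ) * Complex.I); let D : Set (Fin 4 → ℝ) := {z | 0 < z 2 ∧ z 2 < 1 ∧ 0 < z 3 ∧ z 3 < 1}; let J : (Fin 4 → ℝ) → ℝ := fun z => 4 / ((1 + z 0 ^ 2) * (1 + z 1 ^ 2)); let AG : (Fin 4 → ℝ) → ℝ := fun z => ∏ ρ ∈ ({(1, 0), (0, 1), (1, 1), (2, 1), (3, 1), (3, 2)} : Finset (ℕ × ℕ)), ‖1 - e (z 0) ^ ρ.1 * e (z 1) ^ ρ.2‖; ∀ (r r' : Literature.NumberTheory.Transcendental.KZ.IntegralRep 4), r.domain = D → Set.EqOn r.integrand (fun z => J z * (AG z ^ 2 * (z 2 * (1 - z 2)) * (z 3 * (1 - z 3) ^ 5)) ^ (1 / 3 : ℝ)) D → r'.domain = D → Set.EqOn r'.integrand (fun z => J z * (z 2 ^ 2 * z 3 ^ 6) ^ (1 / 3 : ℝ)) D → Literature.NumberTheory.Transcendental.KZ.Equivalent r r'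

/-- item stmt-KontsevichZagierPeriods-12258 · crux · rank 5 · open · by planner
why it might fail: At k ∉ ℕ the only proofs are Opdam/Heckman shift operators + continuation, or integer cases + Carlson; a finitary uniform-in-k mechanism would be a derivation of Carlson's rule on this family — none is known; one inaccessible anchor refutes it and the summit.
sources: Opdam1989, doi:10.1007/bf01239517, Macdonald1982, AndrewsAskeyRoy1999, ForresterWarnaar2008
[crux] THE WHOLE G₂ EXPONENT LINE (gen-1 item, re-typed with EqOn): for every rational k ≥ 0, [D,
J·(|Δ⁺_G₂|²·x(1−x)·y(1−y)⁵)^k] ~ [D, J·(x²y⁶)^k] (I_G₂(k)·B(k+1,k+1)·B(k+1,5k+1) =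
(2π)²/((2k+1)(6k+1)); both weights RATIONAL functions with ℚ-coefficients, bounded by 69 and 1; only
the exponent is fractional). Literally an instance of CarlsonClosure (n = n' = 4, f = f' = J, M =
4096) given G2OpdamLineNat and TorusRepsExist; conversely a rule-free proof needs a mechanism
uniform across all cosets k₀ + ℕ (the Heckman–Opdam shift k → k+1 is plausibly a move chain, gen-1
ShiftIsMoves; the anchors k₀ ∈ (0,1) are the content). [deps: G2OpdamLineNat] [difficulty:
open-problem] -/
@[route_item "route-KontsevichZagierPeriods-CarlsonRule"]
def G2OpdamLine : Prop :=
  let e : ℝ → ℂ := fun s => (1 + (s : ℂ) * Complex.I) / (1 - (s : ℂ) * Complex.I); let D : Set (Fin 4 → ℝ) := {z | 0 < z 2 ∧ z 2 < 1 ∧ 0 < z 3 ∧ z 3 < 1}; let J : (Fin 4 → ℝ) → ℝ := fun z => 4 / ((1 + z 0 ^ 2) * (1 + z 1 ^ 2)); let AG : (Fin 4 → ℝ) → ℝ := fun z => ∏ ρ ∈ ({(1, 0), (0, 1), (1, 1), (2, 1), (3, 1), (3, 2)} : Finset (ℕ × ℕ)), ‖1 - e (z 0) ^ ρ.1 * e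 (z 1) ^ ρ.2‖; ∀ (k : ℚ), 0 ≤ k → ∀ (r r' : Literature.NumberTheory.Transcendental.KZ.IntegralRep 4), r.domain = D → Set.EqOn r.integrand (fun z => J z * (AG z ^ 2 * (z 2 * (1 - z 2)) * (z 3 * (1 - z 3) ^ 5)) ^ (k : ℝ)) D → r'.domain = D → Set.EqOn r'.integrand (fun z => J z * (z 2 ^ 2 * z 3 ^ 6) ^ (k : ℝ)) D → Literature.NumberTheory.Transcendental.KZ.Equivalent r r'

/-- item stmt-KontsevichZagierPeriods-14426 · crux · rank 6 · open · by planner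
why it might fail: False only if the summit is (KZKernelConjecture ⇒ it; with CarlsonClosure it returns the summit); as an obligation it is Conjecture 1 for KZ^C: every Neg pressure point off the exponent direction — regularisation, log/arctan primitives, cancellation of a non-zero period — bears on it.
sources: KontsevichZagier2001, HuberMullerStach2017, Ayoub2015, Boas1954
[crux] Conjecture 1 for KZ^C: ker KZ.eval is contained in every subgroup R ≥ KZ.relations closed
under Carlson's rule (phrased over R exactly as WZCosetWall.SeriesKernel /
LiouvilleUnfolding.LogKernelConjecture). KZKernelConjecture ⇒ it trivially; with CarlsonClosure it
gives the summit back (closes), so it is a load-bearing hypothesis of `closes` that none of the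
cruxes 2–5 reaches — conjecture-grade, hence a ranked crux of this route (route-choice 2026-08-16;
was target #0), of the same shape as ExpConservative.ExpKernelConjecture /
LiouvilleUnfolding.LogKernelConjecture / ExponentCosets.CosetKernel. Ranked last: it moves only with
the structural kernel programme (any proof of KZKernelConjecture closes it), refuters read it as the
summit minus analytic continuation in exponents, and disprovers can fix its standing (CarlsonKernel
⟺ ker KZ.eval ≤ Carlson-closure of KZ.relations; CarlsonKernel ∧ CarlsonClosure ⟺
KZKernelConjecture). why it might fail: false only if the summit is; as an obligation it is
Conjecture 1 for KZ^C, bearing every Neg pressure point off the exponent direction (regularisation,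
log/arctan primitives, cancellation of a non-zero period). sources: KontsevichZagie -/
@[route_item "route-KontsevichZagierPeriods-CarlsonRule", crux]
def CarlsonKernel : Prop :=
  ∀ (R : AddSubgroup Literature.NumberTheory.Transcendental.KZ.FormalRep), Literature.NumberTheory.Transcendental.KZ.relations ≤ R → (∀ (n n' : ℕ) (σ : Set (Fin n → ℝ)) (τ : Set (Fin n' → ℝ)) (f g : (Fin n → ℝ) → ℝ) (f' g' : (Fin n' → ℝ) → ℝ) (M : ℝ) (r : ℕ → Literature.NumberTheory.Transcendental.KZ.IntegralRep n) (s : ℕ → Literature.NumberTheory.Transcendental.KZ.IntegralRep n'), (∀ x ∈ σ, 0 ≤ g x ∧ g x ≤ M) → (∀ y ∈ τ, 0 ≤ g' y ∧ g' y ≤ M) → (∀ m, (r m).domain = σ ∧ Set.EqOn (r m).integrand (fun x => f x * g x ^ m) σ) → (∀ m, (s m).domain = τ ∧ Set.EqOn (s m).integrand (fun y => f' y * g' y ^ m) τ) → (∀ m, Literature.NumberTheory.Transcendental.KZ.of (r m) - Literature.NumberTheory.Transcendental.KZ.of (s m) ∈ R) → ∀ (k : ℚ), 0 ≤ k → ∀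 (rk : Literature.NumberTheory.Transcendental.KZ.IntegralRep n) (sk : Literature.NumberTheory.Transcendental.KZ.IntegralRep n'), rk.domain = σ → Set.EqOn rk.integrand (fun x => f x * g x ^ (k : ℝ)) σ → sk.domain = τ → Set.EqOn sk.integrand (fun y => f' y * g' y ^ (k : ℝ)) τ → Literature.NumberTheory.Transcendental.KZ.of rk - Literature.NumberTheory.Transcendental.KZ.of sk ∈ R) → ∀ c : Literature.NumberTheory.Transcendental.KZ.FormalRep, Literature.NumberTheory.Transcendental.KZ.eval c = 0 → c ∈ R

/-- item stmt-KontsevichZagierPeriods-12259 · support · rank 9 · open · by planner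
sources: Macdonald1982, Opdam1989, doi:10.1137/0518065, ForresterWarnaar2008
[support] INTEGER POINTS ARE ACCESSIBLE: for m ∈ ℕ the two representations of G2OpdamLine (rational
integrands, monoid power) are KZ-equivalent — expand |Δ⁺_G₂|^(2m) into characters (Weyl denominator;
constant term Π binom(m·d_i, m), = 12 = |W(G₂)| at m = 1, Macdonald1982 §1), kill every non-constant
character e^(i(pθ₀+qθ₁)) by one Newton–Leibniz move on the torus with a RATIONAL primitive in t,
evaluate the Beta/monomial sides by polynomial primitives, and match the integers by additivity (no
division: both sides carry the same integers). [difficulty: L] -/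
@[route_item "route-KontsevichZagierPeriods-CarlsonRule"]
def G2OpdamLineNat : Prop :=
  let e : ℝ → ℂ := fun s => (1 + (s : ℂ) * Complex.I) / (1 - (s : ℂ) * Complex.I); let D : Set (Fin 4 → ℝ) := {z | 0 < z 2 ∧ z 2 < 1 ∧ 0 < z 3 ∧ z 3 < 1}; let J : (Fin 4 → ℝ) → ℝ := fun z => 4 / ((1 + z 0 ^ 2) * (1 + z 1 ^ 2)); let AG : (Fin 4 → ℝ) → ℝ := fun z => ∏ ρ ∈ ({(1, 0), (0, 1), (1, 1), (2, 1), (3, 1), (3, 2)} : Finset (ℕ × ℕ)), ‖1 - e (z 0) ^ ρ.1 * e (z 1) ^ ρ.2‖; ∀ (m : ℕ) (r r' : Literature.NumberTheory.Transcendental.KZ.IntegralRep 4), r.domain = D → Set.EqOn r.integrand (fun z => J z * (AG z ^ 2 * (z 2 * (1 - z 2)) * (z 3 * (1 - z 3) ^ 5)) ^ m) D → r'.domain = D → Set.EqOn r'.integrand (fun z => J z * (z 2 ^ 2 * z 3 ^ 6) ^ m) D → Literature.NumberTheory.Transcendental.KZ.Equivalent r r'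

/-- item stmt-KontsevichZagierPeriods-12260 · support · rank 9 · open · by planner
sources: Boas1954, AndrewsAskeyRoy1999, ForresterWarnaar2008
[support] VALUE-LEVEL SOUNDNESS OF THE RULE (Carlson 1914): under the hypotheses of CarlsonClosure
with "∈ relations" replaced by equality of values for all m ∈ ℕ, rk.value = sk.value for every
rational k ≥ 0. Proof: H(z) = ∫_σ f·g^z·1_(g>0) − ∫_τ f'·g'^z·1_(g'>0) is analytic on Re z > 0 with
|H(z)| ≤ (‖f‖₁+‖f'‖₁)·max(1,M)^(Re z); z ↦ H(z+1) is regular of exponential type on Re z ≥ 0,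
bounded on iℝ and zero on ℕ, so it vanishes (Boas1954 Thm 9.2.1, indicator 0 < π), H ≡ 0 on Re z > 0
by the identity theorem, and k = 0 is the case m = 0. Mathlib has Phragmén–Lindelöf
(Complex.PhragmenLindelof); Carlson's theorem itself is to be proved in Literature/Analysis/Complex.
Makes summit ⇒ X formal, so X ⟺ summit. [difficulty: L] -/
@[route_item "route-KontsevichZagierPeriods-CarlsonRule"]
def CarlsonSound : Prop :=
  ∀ (n n' : ℕ) (σ : Set (Fin n → ℝ)) (τ : Set (Fin n' → ℝ)) (f g : (Fin n → ℝ) → ℝ) (f' g' : (Fin n' → ℝ) → ℝ) (M : ℝ) (r : ℕ → Literature.NumberTheory.Transcendental.KZ.IntegralRep n) (s : ℕ → Literature.NumberTheory.Transcendental.KZ.IntegralRep n'), (∀ x ∈ σ, 0 ≤ g x ∧ g x ≤ M) → (∀ y ∈ τ, 0 ≤ g' y ∧ g' y ≤ M) → (∀ m, (r m).domain = σ ∧ Set.EqOn (r m).integrand (fun x => f x * g x ^ m) σ) → (∀ m, (s m).domain = τ ∧ Set.EqOn (s m).integrand (fun y => f' y * g' y ^ m) τ) → (∀ m, (r m).value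 = (s m).value) → ∀ (k : ℚ), 0 ≤ k → ∀ (rk : Literature.NumberTheory.Transcendental.KZ.IntegralRep n) (sk : Literature.NumberTheory.Transcendental.KZ.IntegralRep n'), rk.domain = σ → Set.EqOn rk.integrand (fun x => f x * g x ^ (k : ℝ)) σ → sk.domain = τ → Set.EqOn sk.integrand (fun y => f' y * g' y ^ (k : ℝ)) τ → rk.value = sk.value

/-- item stmt-KontsevichZagierPeriods-12261 · support · rank 9 · open · by planner
sources: Macdonald1982, Opdam1989, KontsevichZagier2001
[support] THE k = 1/2 ANCHOR IS RATIONAL AND CONTINUATION-FREE (card (H), calibration): [ℝ²,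
J·|Δ⁺_G₂|] ~ [(0,1)², 512/5] (I_G₂(½) = (2π)²·binom(1,½)·binom(3,½) = 512/5; quadrature
102.39999999). In t-coordinates the integrand is 256·|P(t)|/((1+t₀²)⁶(1+t₁²)⁴), P = Π over G₂⁺ of
Im[(1+it₀)^a(1+it₁)^b] ∈ ℤ[t₀,t₁] of degree 16: PIECEWISE RATIONAL on the sign cells of P, so the
chain is cell decomposition (1a) + rational-function integration with arctan/log unfolded into extra
variables (engines of routes LiouvilleUnfolding / CompiledSubstitutions): the coset 1/2 + ℤ needs no
continuation, in contrast with 1/3 + ℤ. [difficulty: L] -/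
@[route_item "route-KontsevichZagierPeriods-CarlsonRule"]
def G2HalfRational : Prop :=
  let e : ℝ → ℂ := fun s => (1 + (s : ℂ) * Complex.I) / (1 - (s : ℂ) * Complex.I); let J : (Fin 2 → ℝ) → ℝ := fun t => 4 / ((1 + t 0 ^ 2) * (1 + t 1 ^ 2)); let AG : (Fin 2 → ℝ) → ℝ := fun t => ∏ ρ ∈ ({(1, 0), (0, 1), (1, 1), (2, 1), (3, 1), (3, 2)} : Finset (ℕ × ℕ)), ‖1 - e (t 0) ^ ρ.1 * e (t 1) ^ ρ.2‖; ∀ (r r' : Literature.NumberTheory.Transcendental.KZ.IntegralRep 2), r.domain = Set.univ → (∀ t, r.integrand t = J t * AG t) → r'.domain = {z | ∀ i, z i ∈ Set.Ioo (0:ℝ) 1} → Set.EqOn r'.integrand (fun _ => 512 / 5) r'.domain → Literature.NumberTheory.Transcendental.KZ.Equivalent r r'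

/-- item stmt-KontsevichZagierPeriods-12262 · support · rank 9 · open · by planner
sources: KontsevichZagier2001, Macdonald1982
[support] NON-VACUITY: for every rational k ≥ 0 the torus representations [ℝ², J·|Δ⁺_G₂|^(2k)], [ℝ²,
J·|Δ⁺_A₂|^(2k)] and the two Opdam-line representations on D exist as KZ.IntegralRep
(ℚ-semialgebraic: ‖1 − e(t₀)^a e(t₁)^b‖² is a rational function of t, so the graph of a (p/q)-th
power is cut out by v ≥ 0 ∧ v^q·den^p = num^p; integrable: bounded × J ∈ L¹(ℝ²), resp. bounded on a
finite-measure fibre). [difficulty: M] -/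
@[route_item "route-KontsevichZagierPeriods-CarlsonRule"]
def TorusRepsExist : Prop :=
  let e : ℝ → ℂ := fun s => (1 + (s : ℂ) * Complex.I) / (1 - (s : ℂ) * Complex.I); let J : (Fin 2 → ℝ) → ℝ := fun t => 4 / ((1 + t 0 ^ 2) * (1 + t 1 ^ 2)); let AG : (Fin 2 → ℝ) → ℝ := fun t => ∏ ρ ∈ ({(1, 0), (0, 1), (1, 1), (2, 1), (3, 1), (3, 2)} : Finset (ℕ × ℕ)), ‖1 - e (t 0) ^ ρ.1 * e (t 1) ^ ρ.2‖; let AA : (Fin 2 → ℝ) → ℝ := fun t => ∏ ρ ∈ ({(1, 0), (1, 1), (2, 1)} : Finset (ℕ × ℕ)), ‖1 - e (t 0) ^ ρ.1 * e (t 1) ^ ρ.2‖; let D : Set (Fin 4 → ℝ) := {z | 0 < z 2 ∧ z 2 < 1 ∧ 0 < z 3 ∧ z 3 < 1}; let J4 : (Fin 4 → ℝ) → ℝ := fun z => 4 / ((1 + z 0 ^ 2) * (1 + z 1 ^ 2)); let AG4 : (Fin 4 → ℝ) → ℝ := fun z => ∏ ρ ∈ ({(1, 0), (0, 1), (1, 1),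 (2, 1), (3, 1), (3, 2)} : Finset (ℕ × ℕ)), ‖1 - e (z 0) ^ ρ.1 * e (z 1) ^ ρ.2‖; ∀ (k : ℚ), 0 ≤ k → (∃ r : Literature.NumberTheory.Transcendental.KZ.IntegralRep 2, r.domain = Set.univ ∧ ∀ t, r.integrand t = J t * AG t ^ (2 * (k : ℝ))) ∧ (∃ r : Literature.NumberTheory.Transcendental.KZ.IntegralRep 2, r.domain = Set.univ ∧ ∀ t, r.integrand t = J t * AA t ^ (2 * (k : ℝ))) ∧ (∃ r : Literature.NumberTheory.Transcendental.KZ.IntegralRep 4, r.domain = D ∧ Set.EqOn r.integrand (fun z => J4 z * (AG4 z ^ 2 * (z 2 * (1 - z 2)) * (z 3 * (1 - z 3) ^ 5)) ^ (k : ℝ)) D) ∧ (∃ r : Literature.NumberTheory.Transcendental.KZ.IntegralRep 4, r.domain = D ∧ Set.EqOn r.integrand (fun z => J4 z * (z 2 ^ 2 * z 3 ^ 6) ^ (k : ℝ)) D)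

/-- item stmt-KontsevichZagierPeriods-12263 · assembly · rank 1 · closed · proved by Summit.KontsevichZagierPeriods.CarlsonRule.assembly_proof @ 71d4d39983ab (prover) · by planner
sources: KontsevichZagier2001, Boas1954
[assembly] CarlsonClosure → CarlsonKernel → KontsevichZagierPeriods. -/
@[route_item "route-KontsevichZagierPeriods-CarlsonRule"]
def Assembly : Prop :=
  CarlsonClosure → CarlsonKernel → KontsevichZagierPeriods

/-! D-0027 §2.1 — DECIDING THEOREM (planner-authored via `route open/edit --closes-file`; by planner-plancard-KontsevichZagierPeriods-Kont-fcbef4f7-g2-0 2026-08-15T18:51:54Z):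
its hypotheses are this route's items and its conclusion the sub-problem Statement (glue_lint), and it elaborates with this file. -/

@[closes "route-KontsevichZagierPeriods-CarlsonRule"] theorem closes : CarlsonClosure → CarlsonKernel → KontsevichZagierPeriods := by
  intro hC hK n m r r' _ _ hv
  apply hK Literature.NumberTheory.Transcendental.KZ.relations le_rfl hC
  simp [Literature.NumberTheory.Transcendental.KZ.eval_of, hv]

end Summit.KontsevichZagierPeriods.KontsevichZagierPeriods.Theses.CarlsonRule
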